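import Summits.ValiantsHypothesis.ValiantsHypothesis.Theses.ChowBorderDepth3
import Summits.ValiantsHypothesis.ValiantsHypothesis.Theorems.ChowBorderDepth3Depth3ChasmPaddedChasm
import Summits.ValiantsHypothesis.ValiantsHypothesis.Theorems.ChowBorderDepth3Depth3ChasmChasmExponent

/-!
# Birth skeleton for crux `Depth3Chasm` (item stmt-ValiantsHypothesis-5935)

Route `route-ValiantsHypothesis-ChowBorderDepth3` (crux shared with `route-ValiantsHypothesis-SummationBits`).
Crux (route decl `Summit.ValiantsHypothesis.ValiantsHypothesis.Theses.ChowBorderDepth3.Depth3Chasm`):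
every VP family `f` over `ℂ` (arbitrary finite variable types `σ n`) has, for some `c` and all `n`,
a product-depth-`≤ 1` (`ΣΠΣ`) circuit computing `f n` with at most `(n+2)^(c⌊√(deg f_n)⌋ + c)` wires.

LINE. The printed depth-three chasm (Tavenas 2015 Cor. 1 sharpening GKKS 2016 Thm. 1.1) is in the
tree as the named fact `Literature.Computability.AlgebraicComplexity.sigmaPiSigma_edgeSize_le_of_complexity`
(`DepthThreeChasm.lean`) and is DISCHARGED (`…_holds`, `DepthThreeChasmProofs.lean`, `K = 100a + 600`) —
but only for polynomials in `Fin n` variables with `deg ≤ n^a + a` where `n` is the NUMBER OF VARIABLES.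
A VP family may have few variables and large degree (e.g. `x^n`: one variable, degree `n`), and lives
on arbitrary finite types `σ n`; so the crux needs two genuine further steps:

* `stub_paddedChasm` — the chasm with a FREE size parameter `m` dominating both the degree and the
  number of variables, over an arbitrary finite variable type `τ` (pad `τ ↪ τ ⊕ Fin m ≃ Fin N'`,
  apply the `Fin`-form fact at `N' ≥ m` variables, rename the circuit back along a retraction;
  `lg N' ≤ (3a+6) lg m`).
* `stub_chasmExponent` — the p-bounded exponent arithmetic: for `d, s ≤ m^a + a`,
  `2^(K⌊√(d (log₂ m + 1)(log₂ s + 1))⌋ + K) ≤ (m+2)^(c⌊√d⌋ + c)` for some `c = c(a, K)`.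

`Depth3Chasm_of` assembles them (real proof): unpack `IsVPFamily` into ONE exponent `a` bounding
`#σ n + deg f_n + L(f_n)` (via `IsPBounded.add_holds`), take `K` from the first stub and `c` from
the second, and chain the two bounds at `m := n`, `d := deg f_n`, `s := L(f_n)`.

## Shape (skeleton audit by-name rule, as in `Cruxes/ContractiveHardness/Lines/birth.lean`)
* `Stmt.stub_…` — the two stub statements as precise `Prop`s, named like the stubs;
* `stub_…` — the same statements (the REGISTERED stubs), now CLOSED by the landed Theorems files
  `ChowBorderDepth3Depth3ChasmPaddedChasm.lean` (p146582) and `ChowBorderDepth3Depth3ChasmChasmExponent.lean`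
  (p146568) — no `sorry` remains;
* `Depth3Chasm_of : Stmt.stub_paddedChasm → Stmt.stub_chasmExponent → Depth3Chasm` — the composition,
  real proof; `Depth3Chasm_proof : Depth3Chasm := Depth3Chasm_of stub_paddedChasm stub_chasmExponent`
  ties the two copies (the compiler checks that the `Stmt` copies and the stub statements agree).
Both stubs are DEF-FREE beyond Mathlib + `Literature.Computability.AlgebraicComplexity`
(`ArithCircuit`, `Computes`, `productDepth`, `edgeSize`, `complexity`), so each can land as
`Theorems/ChowBorderDepth3Depth3Chasm<Stub>.lean` with `--supports stmt-ValiantsHypothesis-5935`.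
-/

namespace Summit.ValiantsHypothesis.ValiantsHypothesis.Cruxes.Depth3Chasm.Birth

open Literature.Computability.AlgebraicComplexity

/-- Statement of STUB 1 (padded / transported depth-three chasm; Tavenas 2015 Cor. 1, GKKS 2016
Thm. 1.1, in family-ready form). For every exponent `a` there is `K` such that every `f ∈ ℂ[τ]`,
`τ` any finite type, with `deg f ≤ d ≤ m^a + a`, `#τ ≤ m^a + a` and fan-in-two complexity `≤ s` —
`m` a free size parameter — has a product-depth-`≤ 1` circuit with at most
`2^(K⌊√(d (log₂ m + 1)(log₂ s + 1))⌋ + K)` wires. Why plausibly true: provable from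
`sigmaPiSigma_edgeSize_le_of_complexity_holds` (DepthThreeChasmProofs.lean) by padding the variables
to `Fin (#τ + m)` (`totalDegree_rename_le`, `complexity_rename_of_injective_holds`), renaming the
resulting circuit back along a retraction (`ArithCircuit.eval_rename_apply`, `edgeSize_rename`,
`productDepth_rename` of DepthThreeChasmCircuits.lean; `τ` empty ⇒ `f` constant ⇒ `ofConst`,
0 wires), and absorbing `lg (#τ + m) ≤ (3a+6) · lg m`, `⌊√(C X)⌋ ≤ C ⌊√X⌋ + C` into `K' = K (3a+6) + K`.
Why it might fail: only a mis-transcribed degenerate case (`m ≤ 1`, `d = 0`), all covered by the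
additive `K`. Size: M. -/
def Stmt.stub_paddedChasm : Prop :=
  ∀ a : ℕ, ∃ K : ℕ, ∀ {τ : Type} [Fintype τ] (m s d : ℕ) (f : MvPolynomial τ ℂ),
    f.totalDegree ≤ d → d ≤ m ^ a + a → Fintype.card τ ≤ m ^ a + a → complexity f ≤ s →
      ∃ P : ArithCircuit ℂ τ, P.Computes f ∧ P.productDepth ≤ 1 ∧
        P.edgeSize ≤ 2 ^ (K * Nat.sqrt (d * (Nat.log 2 m + 1) * (Nat.log 2 s + 1)) + K)

/-- Statement of STUB 2 (the p-bounded exponent arithmetic of the transcription). For all `a, K`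
there is `c` with `2^(K⌊√(d (log₂ m + 1)(log₂ s + 1))⌋ + K) ≤ (m+2)^(c⌊√d⌋ + c)` whenever
`d, s ≤ m^a + a`. Why plausibly true: `log₂ s + 1 ≤ (a+2)(log₂ (m+2) + 1)`, `log₂ m + 1 ≤ ℓ :=
log₂ (m+2) + 1`, `⌊√(d A ℓ²)⌋ ≤ ℓ (A ⌊√d⌋ + A + 1)`, `2^ℓ ≤ (m+2)²`; so `c = 2K(A+1) + K` works
(`d = 0`, `m ≤ 1` are covered by the additive constants). Helper lemmas `DepthThree.lg_mul_le`,
`lg_pow_le`, `le_mul_sqrt_add`, `pow_add_le_pow` in DepthThreeChasmProofs.lean. Why it might fail: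
it cannot for `∃ c`; only the constant is delicate. Size: M (Nat.log / Nat.sqrt bookkeeping). -/
def Stmt.stub_chasmExponent : Prop :=
  ∀ a K : ℕ, ∃ c : ℕ, ∀ m d s : ℕ, d ≤ m ^ a + a → s ≤ m ^ a + a →
    2 ^ (K * Nat.sqrt (d * (Nat.log 2 m + 1) * (Nat.log 2 s + 1)) + K) ≤
      (m + 2) ^ (c * Nat.sqrt d + c)

/-- Registered STUB 1 = `Stmt.stub_paddedChasm` (the depth-three chasm with a free size parameter,
over an arbitrary finite variable type). [cite: Tavenas2015, Cor. 1] [cite: GuptaKamathKayalSaptharishi2016, Thm. 1.1] -/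
theorem stub_paddedChasm :
    ∀ a : ℕ, ∃ K : ℕ, ∀ {τ : Type} [Fintype τ] (m s d : ℕ) (f : MvPolynomial τ ℂ),
      f.totalDegree ≤ d → d ≤ m ^ a + a → Fintype.card τ ≤ m ^ a + a → complexity f ≤ s →
        ∃ P : ArithCircuit ℂ τ, P.Computes f ∧ P.productDepth ≤ 1 ∧
          P.edgeSize ≤ 2 ^ (K * Nat.sqrt (d * (Nat.log 2 m + 1) * (Nat.log 2 s + 1)) + K) :=
  -- LANDED: Theorems/ChowBorderDepth3Depth3ChasmPaddedChasm.lean (p146582)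
  Summit.ValiantsHypothesis.ValiantsHypothesis.Theorems.ChowBorderDepth3Depth3Chasm.stub_paddedChasm

/-- Registered STUB 2 = `Stmt.stub_chasmExponent` (p-bounded exponent arithmetic). -/
theorem stub_chasmExponent :
    ∀ a K : ℕ, ∃ c : ℕ, ∀ m d s : ℕ, d ≤ m ^ a + a → s ≤ m ^ a + a →
      2 ^ (K * Nat.sqrt (d * (Nat.log 2 m + 1) * (Nat.log 2 s + 1)) + K) ≤
        (m + 2) ^ (c * Nat.sqrt d + c) :=
  -- LANDED: Theorems/ChowBorderDepth3Depth3ChasmChasmExponent.lean (p146568)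
  Summit.ValiantsHypothesis.ValiantsHypothesis.Theorems.ChowBorderDepth3Depth3Chasm.stub_chasmExponent

/-- COMPOSITION (kernel-checked, no sorry): the two stub statements imply the crux `Depth3Chasm`
BY NAME. Unpacks `IsVPFamily f` (`#σ n`, `deg f_n`, `L(f_n)` p-bounded) into a single exponent
via `IsPBounded.add_holds`, then chains STUB 1 (at `m := n`) with STUB 2. -/
theorem Depth3Chasm_of :
    Stmt.stub_paddedChasm → Stmt.stub_chasmExponent →
      Summit.ValiantsHypothesis.ValiantsHypothesis.Theses.ChowBorderDepth3.Depth3Chasm := by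
  intro hChasm hExp
  unfold Stmt.stub_paddedChasm at hChasm
  unfold Stmt.stub_chasmExponent at hExp
  intro σ _ f hf
  -- `IsVPFamily f = (IsPBounded #σ ∧ IsPBounded deg) ∧ IsPBounded L`
  obtain ⟨⟨hcard, hdeg⟩, hcomp⟩ := hf
  -- one exponent for all three p-bounded quantities
  obtain ⟨a, ha⟩ := IsPBounded.add_holds (IsPBounded.add_holds hcard hdeg) hcomp
  obtain ⟨K, hK⟩ := hChasm a
  obtain ⟨c, hc⟩ := hExp a K
  refine ⟨c, fun n => ?_⟩
  have hn : Fintype.card (σ n) + (f n).totalDegree + complexity (f n) ≤ n ^ a + a := ha n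
  have hcard' : Fintype.card (σ n) ≤ n ^ a + a :=
    le_trans (le_trans (Nat.le_add_right _ _) (Nat.le_add_right _ _)) hn
  have hdeg' : (f n).totalDegree ≤ n ^ a + a :=
    le_trans (le_trans (Nat.le_add_left _ _) (Nat.le_add_right _ _)) hn
  have hcomp' : complexity (f n) ≤ n ^ a + a := le_trans (Nat.le_add_left _ _) hn
  obtain ⟨P, hP, hpd, hE⟩ :=
    hK n (complexity (f n)) (f n).totalDegree (f n) le_rfl hdeg' hcard' le_rfl
  exact ⟨P, hP, hpd, hE.trans (hc n (f n).totalDegree (complexity (f n)) hdeg' hcomp')⟩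

/-- THE SKELETON: the crux, modulo exactly the two registered stubs (the compiler checks that the
`Stmt` copies and the stub statements agree). -/
theorem Depth3Chasm_proof :
    Summit.ValiantsHypothesis.ValiantsHypothesis.Theses.ChowBorderDepth3.Depth3Chasm :=
  Depth3Chasm_of stub_paddedChasm stub_chasmExponent

end Summit.ValiantsHypothesis.ValiantsHypothesis.Cruxes.Depth3Chasm.Birth
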